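import Literature.RingTheory.HilbertSamuel.HypersurfaceSection
import Mathlib.RingTheory.Localization.AtPrime.Basic
import Mathlib.RingTheory.LocalRing.Length
import Mathlib.Algebra.Polynomial.Coeff
import Mathlib.Algebra.Polynomial.Eval.Defs
import Mathlib.Algebra.Polynomial.Taylor
import HarnessLib

/-!
# The Hilbert function of `A⟨X⟩ = A[X]_{(𝔪, X)}` is `H^{(1)}_A`
# (the transcendental base-change step in CJS 2020, proof of Thm. 3.10, p. 47)

Topic: `Literature/RingTheory/HilbertSamuel`. In the reduction of Thm. 3.10 of
Cossart–Jannsen–Saito (LNM 2270, proof, p. 47, "by the same technique as in [H4]") to the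
residually rational case, the source is base-changed along `i : X̃ → X`, "a faithfully flat
monogenic map which is either finite or the projection `𝔸¹_X → X`", and the point `x'` is
replaced by a point `x̃'` of `𝔸¹_{X'}` (resp. of `X' ×_X X̃`) over it with `k(x̃') = k(x')`; the
local ring at such a point is `𝒪_{X',x'}[T]` localized at the maximal ideal `(𝔪_{x'}, T − a)`
(resp. a hypersurface `G = 0` in it), and the printed inequalities
"`H^{(1+δ)}_{𝒪_{X',x'}} ≤ H^{(1+δ̃)}_{𝒪_{X̃',x̃'}}`" rest on the computation of the Hilbert
function of this POINT EXTENSION: for a Noetherian local ring `(A, 𝔪, k)` and the maximal ideal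
`𝔑 = (𝔪, X) ⊆ A[X]` (the kernel of `A[X] → A → k`, `X ↦ 0`),

  `H^{(0)}_{A[X]_𝔑} = H^{(1)}_A`, i.e. `H^{(1)}_{A[X]_𝔑}(n) = H^{(2)}_A(n)` for all `n`.

PROVED here (for any localization `L` of `A[X]` at `𝔑`, and then for the maximal ideal
`𝔑_a = (𝔪, X − a)` of any rational point, reduced to `a = 0` by the `A`-automorphism `X ↦ X + a`,
Mathlib `Polynomial.taylorEquiv`):

* `mem_comap_evalRingHom_zero`, `isMaximal_comap_evalRingHom` — `𝔑 = {p | p(0) ∈ 𝔪}` is maximal;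
* `coeff_mem_pow_of_mem_comap_evalRingHom_zero_pow`,
  `mem_comap_evalRingHom_zero_pow_of_coeff_mem_pow` — **`𝔑^m = {p | coeff_j p ∈ 𝔪^{m−j} ∀ j}`**;
* `length_quotient_comap_evalRingHom_zero_pow` — `ℓ_A(A[X]/𝔑^{n+1}) = Σ_{j ≤ n} ℓ_A(A/𝔪^{j+1})`
  (`A[X]/𝔑^{n+1} ≅ ⊕_{j ≤ n} A/𝔪^{n+1−j}` as `A`-modules, by the coefficients);
* `hilbertSamuelFun_one_pointExtension`, `hilbertFun_pointExtension` — **the Hilbert function of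
  `L = A[X]_𝔑`**: `H^{(1)}_L = H^{(2)}_A`, `H^{(0)}_L = H^{(1)}_A` (`ℓ_L(L/𝔪_L^{n+1}) = ℓ_A(A[X]/𝔑^{n+1})`
  because `L/𝔪_L^{n+1} ≅ A[X]/𝔑^{n+1}`, Mathlib `IsLocalization.AtPrime.equivQuotMaximalIdealPow`,
  and `A → L/𝔪_L^{n+1}` is a residually rational local homomorphism, Mathlib
  `IsLocalRing.length_restrictScalars`);
* `hilbertSamuelFun_one_pointExtension_eval`, `hilbertFun_pointExtension_eval` — the same for
  `𝔑_a = (𝔪, X − a)`, `a ∈ A`.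

No definitions and no named facts are introduced.

## Sources

* V. Cossart, U. Jannsen, S. Saito, LNM 2270 (2020), proof of Thm. 3.10, p. 47 (the base change
  `𝔸¹_X → X` and the points `x̃'`). [CossartJannsenSaito2020]
* H. Hironaka, *Certain numerical characters of singularities*, J. Math. Kyoto Univ. 10 (1970)
  (= [H4] of CJS), the "same technique". Background.
-/

noncomputable section

open Polynomial IsLocalRing Finset

namespace Literature.RingTheory.HilbertSamuel

universe u v

variable {A : Type u} [CommRing A] [IsLocalRing A]

/-! ## The maximal ideal `𝔑 = (𝔪, X)` of `A[X]` and its powers -/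

/-- `p ∈ 𝔑 = (𝔪, X)` iff its constant coefficient lies in `𝔪`. [folklore] -/
theorem mem_comap_evalRingHom_zero {p : A[X]} :
    p ∈ (maximalIdeal A).comap (evalRingHom 0) ↔ p.coeff 0 ∈ maximalIdeal A := by
  rw [Ideal.mem_comap, coe_evalRingHom, coeff_zero_eq_eval_zero]

/-- `𝔑_a = {p | p(a) ∈ 𝔪}` is a maximal ideal of `A[X]` (the kernel of `A[X] → A/𝔪`, `X ↦ a`).
[folklore] -/
theorem isMaximal_comap_evalRingHom (a : A) :
    ((maximalIdeal A).comap (evalRingHom a)).IsMaximal :=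
  Ideal.comap_isMaximal_of_surjective _ fun r => ⟨C r, eval_C⟩

/-- `C(𝔪) ⊆ 𝔑`. [folklore] -/
theorem map_C_maximalIdeal_le_comap_evalRingHom_zero :
    (maximalIdeal A).map (C : A →+* A[X]) ≤ (maximalIdeal A).comap (evalRingHom 0) := by
  rw [Ideal.map_le_iff_le_comap]
  intro r hr
  rw [Ideal.mem_comap, mem_comap_evalRingHom_zero, coeff_C_zero]
  exact hr

/-- **`𝔑^m ⊆ {p | coeff_j p ∈ 𝔪^{m−j}}`** (induction on `m` over the products `𝔑^m · 𝔑`: the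
`j`-th coefficient of `q r` is `Σ_{i+l=j} q_i r_l ∈ 𝔪^{m−i} 𝔪^{1−l} ⊆ 𝔪^{m+1−j}`). [folklore] -/
theorem coeff_mem_pow_of_mem_comap_evalRingHom_zero_pow :
    ∀ (m : ℕ) {p : A[X]}, p ∈ (maximalIdeal A).comap (evalRingHom 0) ^ m →
      ∀ j : ℕ, p.coeff j ∈ maximalIdeal A ^ (m - j)
  | 0, p, _, j => by
    rw [Nat.zero_sub, pow_zero, Ideal.one_eq_top]
    exact Submodule.mem_top
  | m + 1, p, hp, j => by
    rw [pow_succ] at hp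
    refine Submodule.mul_induction_on hp (fun q hq r hr => ?_) (fun x y hx hy => ?_)
    · rw [coeff_mul]
      refine Ideal.sum_mem _ fun x hx => ?_
      have hxj : x.1 + x.2 = j := mem_antidiagonal.mp hx
      have h1 := coeff_mem_pow_of_mem_comap_evalRingHom_zero_pow m hq x.1
      have h2 : r.coeff x.2 ∈ maximalIdeal A ^ (1 - x.2) := by
        rcases Nat.eq_zero_or_pos x.2 with h0 | hpos
        · rw [h0, Nat.sub_zero, pow_one]
          exact mem_comap_evalRingHom_zero.mp hr
        · rw [Nat.sub_eq_zero_of_le hpos, pow_zero, Ideal.one_eq_top]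
          exact Submodule.mem_top
      have h12 := Ideal.mul_mem_mul h1 h2
      rw [← pow_add] at h12
      exact Ideal.pow_le_pow_right (by omega) h12
    · rw [coeff_add]
      exact Ideal.add_mem _ hx hy

/-- **`{p | coeff_j p ∈ 𝔪^{m−j}} ⊆ 𝔑^m`** (`p = Σ_j C(p_j) X^j` with `C(p_j) ∈ 𝔑^{m−j}` and
`X^j ∈ 𝔑^j`). [folklore] -/
theorem mem_comap_evalRingHom_zero_pow_of_coeff_mem_pow (m : ℕ) {p : A[X]}
    (h : ∀ j : ℕ, p.coeff j ∈ maximalIdeal A ^ (m - j)) :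
    p ∈ (maximalIdeal A).comap (evalRingHom 0) ^ m := by
  rw [p.as_sum_support_C_mul_X_pow]
  refine Ideal.sum_mem _ fun j _ => ?_
  have hC : C (p.coeff j) ∈ (maximalIdeal A).comap (evalRingHom 0) ^ (m - j) := by
    have : C (p.coeff j) ∈ ((maximalIdeal A).map (C : A →+* A[X])) ^ (m - j) := by
      rw [← Ideal.map_pow]
      exact Ideal.mem_map_of_mem _ (h j)
    exact Ideal.pow_right_mono map_C_maximalIdeal_le_comap_evalRingHom_zero _ this
  have hX : (X : A[X]) ^ j ∈ (maximalIdeal A).comap (evalRingHom 0) ^ j := by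
    refine Ideal.pow_mem_pow ?_ j
    rw [mem_comap_evalRingHom_zero, coeff_X_zero]
    exact Ideal.zero_mem _
  have hCX := Ideal.mul_mem_mul hC hX
  rw [← pow_add] at hCX
  exact Ideal.pow_le_pow_right (by omega) hCX

/-! ## `ℓ_A(A[X]/𝔑^{n+1}) = Σ_{j ≤ n} ℓ_A(A/𝔪^{j+1})` -/

/-- **`ℓ_A(A[X]/𝔑^{n+1}) = Σ_{j ≤ n} H^{(1)}_A(j) = H^{(2)}_A(n)`**: the `A`-linear map
`A[X] → ⊕_{j ≤ n} A/𝔪^{n−j+1}`, `p ↦ (p_j mod 𝔪^{n−j+1})_j`, is onto with kernel `𝔑^{n+1}`.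
[folklore] -/
theorem length_quotient_comap_evalRingHom_zero_pow [IsNoetherianRing A] (n : ℕ) :
    Module.length A (A[X] ⧸ ((maximalIdeal A).comap (evalRingHom 0) ^ (n + 1)).restrictScalars A) =
      (hilbertSamuelFun A 2 n : ℕ∞) := by
  classical
  set 𝔑 : Ideal A[X] := (maximalIdeal A).comap (evalRingHom 0) with h𝔑
  -- the coefficient map
  let M : Fin (n + 1) → Type u := fun j => A ⧸ maximalIdeal A ^ (n - (j : ℕ) + 1)
  let Λ : A[X] →ₗ[A] ((j : Fin (n + 1)) → M j) :=
    LinearMap.pi fun j => (maximalIdeal A ^ (n - (j : ℕ) + 1)).mkQ ∘ₗ lcoeff A (j : ℕ)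
  have hΛ : ∀ (p : A[X]) (j : Fin (n + 1)),
      Λ p j = Submodule.Quotient.mk (p := maximalIdeal A ^ (n - (j : ℕ) + 1)) (p.coeff j) :=
    fun _ _ => rfl
  -- onto: lift each component and take the polynomial with these coefficients
  have hsurj : Function.Surjective Λ := by
    intro y
    choose r hr using fun j : Fin (n + 1) =>
      Submodule.Quotient.mk_surjective (maximalIdeal A ^ (n - (j : ℕ) + 1)) (y j)
    refine ⟨∑ j : Fin (n + 1), C (r j) * X ^ (j : ℕ), funext fun j => ?_⟩
    rw [hΛ, finsetSum_coeff]
    have : ∀ l : Fin (n + 1), (C (r l) * X ^ (l : ℕ)).coeff (j : ℕ) = if l = j then r j else 0 := by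
      intro l
      rw [coeff_C_mul_X_pow]
      by_cases hlj : l = j
      · subst hlj; simp
      · have : (j : ℕ) ≠ (l : ℕ) := fun h => hlj (Fin.ext h.symm)
        rw [if_neg this, if_neg hlj]
    simp_rw [this, Finset.sum_ite_eq', Finset.mem_univ, if_true]
    exact hr j
  -- kernel `= 𝔑^{n+1}`
  have hker : LinearMap.ker Λ = (𝔑 ^ (n + 1)).restrictScalars A := by
    ext p
    rw [LinearMap.mem_ker, Submodule.restrictScalars_mem]
    constructor
    · intro hp
      refine mem_comap_evalRingHom_zero_pow_of_coeff_mem_pow (n + 1) fun j => ?_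
      by_cases hj : j ≤ n
      · have hpj := congrFun hp ⟨j, Nat.lt_succ_of_le hj⟩
        rw [hΛ, Pi.zero_apply, Submodule.Quotient.mk_eq_zero] at hpj
        have : n + 1 - j = n - j + 1 := by omega
        rw [this]
        exact hpj
      · rw [Nat.sub_eq_zero_of_le (by omega), pow_zero, Ideal.one_eq_top]
        exact Submodule.mem_top
    · intro hp
      funext j
      rw [hΛ, Pi.zero_apply, Submodule.Quotient.mk_eq_zero]
      have := coeff_mem_pow_of_mem_comap_evalRingHom_zero_pow (n + 1) hp j
      have hj : n + 1 - (j : ℕ) = n - (j : ℕ) + 1 := by omega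
      rw [hj] at this
      exact this
  -- lengths
  rw [← (Submodule.quotEquivOfEq _ _ hker).length_eq,
    (LinearMap.quotKerEquivOfSurjective Λ hsurj).length_eq, Module.length_pi_of_fintype]
  have hterm : ∀ j : Fin (n + 1),
      Module.length A (M j) = (hilbertSamuelFun A 1 (n - (j : ℕ)) : ℕ∞) := fun j =>
    (hilbertSamuelFun_one_eq_length A (n - (j : ℕ))).symm
  simp_rw [hterm]
  rw [← Nat.cast_sum, Nat.cast_inj, hilbertSamuelFun_succ_apply,
    Fin.sum_univ_eq_sum_range (fun j => hilbertSamuelFun A 1 (n - j)) (n + 1)]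
  have := Finset.sum_range_reflect (hilbertSamuelFun A 1) (n + 1)
  simp only [Nat.add_sub_cancel] at this
  exact this

/-! ## The Hilbert function of `A[X]_𝔑` -/

section Localization

variable [IsNoetherianRing A] (𝔑 : Ideal A[X]) (h𝔑 : 𝔑 = (maximalIdeal A).comap (evalRingHom 0))
  [𝔑.IsMaximal] (L : Type v) [CommRing L] [IsLocalRing L] [IsNoetherianRing L] [Algebra A[X] L]
  [IsLocalization.AtPrime L 𝔑]

include h𝔑 in
/-- **`H^{(1)}_{A[X]_𝔑}(n) = H^{(2)}_A(n)`** for `𝔑 = (𝔪, X)` and any localization `L` of `A[X]`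
at `𝔑` which is a Noetherian local ring: `ℓ_L(L/𝔪_L^{n+1}) = ℓ_A(A[X]/𝔑^{n+1})` (the two rings
agree, and `A → L/𝔪_L^{n+1}` is a residually rational local homomorphism, so `A`-length is
length), `= Σ_{j ≤ n} H^{(1)}_A(j)`. [cite: CossartJannsenSaito2020, proof of Thm. 3.10, p. 47] -/
theorem hilbertSamuelFun_one_pointExtension (n : ℕ) :
    hilbertSamuelFun L 1 n = hilbertSamuelFun A 2 n := by
  classical
  -- `L/𝔪_L^{n+1}` as an `A`-algebra
  letI : Algebra A L := ((algebraMap A[X] L).comp (C : A →+* A[X])).toAlgebra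
  haveI : IsScalarTower A A[X] L := IsScalarTower.of_algebraMap_eq fun _ => rfl
  set JL : Ideal L := maximalIdeal L ^ (n + 1) with hJL
  have hJLne : JL ≠ ⊤ := fun h => (maximalIdeal.isMaximal L).ne_top
    (top_le_iff.mp (h ▸ Ideal.pow_le_self (Nat.succ_ne_zero n)))
  haveI : Nontrivial (L ⧸ JL) := Ideal.Quotient.nontrivial_iff.mpr hJLne
  haveI : IsLocalRing (L ⧸ JL) := IsLocalRing.of_surjective' _ Ideal.Quotient.mk_surjective
  have h𝔑L : 𝔑.map (algebraMap A[X] L) = maximalIdeal L :=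
    IsLocalization.AtPrime.map_eq_maximalIdeal 𝔑 L
  have hmaxQ : (maximalIdeal L).map (algebraMap L (L ⧸ JL)) = maximalIdeal (L ⧸ JL) :=
    map_maximalIdeal_eq_of_surjective (A := L) (B := L ⧸ JL) Ideal.Quotient.mk_surjective
  have hψ : ∀ r : A, algebraMap A (L ⧸ JL) r = algebraMap L (L ⧸ JL) (algebraMap A[X] L (C r)) :=
    fun _ => rfl
  -- `A → L/𝔪_L^{n+1}` is local
  haveI : IsLocalHom (algebraMap A (L ⧸ JL)) := by
    refine ⟨fun r hr => ?_⟩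
    by_contra hru
    have h1 : C r ∈ 𝔑 := by
      rw [h𝔑, Ideal.mem_comap, coe_evalRingHom, eval_C]
      exact hru
    have h2 : algebraMap A[X] L (C r) ∈ maximalIdeal L := h𝔑L ▸ Ideal.mem_map_of_mem _ h1
    have h3 : algebraMap A (L ⧸ JL) r ∈ maximalIdeal (L ⧸ JL) := by
      rw [hψ, ← hmaxQ]
      exact Ideal.mem_map_of_mem _ h2
    exact (IsLocalRing.mem_maximalIdeal _).mp h3 hr
  -- and residually rational
  have hrat : ∀ q : L ⧸ JL, ∃ r : A, q - algebraMap A (L ⧸ JL) r ∈ maximalIdeal (L ⧸ JL) := by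
    intro q
    obtain ⟨ℓ, rfl⟩ := Ideal.Quotient.mk_surjective q
    obtain ⟨p', hp'⟩ := (IsLocalization.AtPrime.equivQuotMaximalIdeal 𝔑 L).surjective
      (Ideal.Quotient.mk (maximalIdeal L) ℓ)
    obtain ⟨p, rfl⟩ := Ideal.Quotient.mk_surjective p'
    rw [IsLocalization.AtPrime.equivQuotMaximalIdeal_apply_mk,
      Ideal.Quotient.mk_eq_mk_iff_sub_mem] at hp'
    -- `p ≡ C (p 0)` modulo `𝔑`
    have hpC : p - C (p.coeff 0) ∈ 𝔑 := by
      rw [h𝔑, mem_comap_evalRingHom_zero, coeff_sub, coeff_C_zero, sub_self]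
      exact Ideal.zero_mem _
    have hpC' : algebraMap A[X] L p - algebraMap A[X] L (C (p.coeff 0)) ∈ maximalIdeal L := by
      rw [← map_sub, ← h𝔑L]
      exact Ideal.mem_map_of_mem _ hpC
    refine ⟨p.coeff 0, ?_⟩
    have hmem : ℓ - algebraMap A[X] L (C (p.coeff 0)) ∈ maximalIdeal L := by
      have : ℓ - algebraMap A[X] L (C (p.coeff 0)) =
          (algebraMap A[X] L p - algebraMap A[X] L (C (p.coeff 0))) - (algebraMap A[X] L p - ℓ) := by
        ring
      rw [this]
      exact Ideal.sub_mem _ hpC' hp'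
    rw [hψ, ← hmaxQ]
    have := Ideal.mem_map_of_mem (algebraMap L (L ⧸ JL)) hmem
    rwa [map_sub] at this
  have hres : Function.Surjective (algebraMap (ResidueField A) (ResidueField (L ⧸ JL))) := by
    intro x
    obtain ⟨q, rfl⟩ := IsLocalRing.residue_surjective x
    obtain ⟨r, hr⟩ := hrat q
    refine ⟨IsLocalRing.residue A r, ?_⟩
    rw [IsLocalRing.ResidueField.algebraMap_residue]
    change Ideal.Quotient.mk _ (algebraMap A (L ⧸ JL) r) = Ideal.Quotient.mk _ q
    rw [Ideal.Quotient.mk_eq_mk_iff_sub_mem]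
    have := Ideal.neg_mem_iff (I := maximalIdeal (L ⧸ JL)) |>.mpr hr
    rwa [neg_sub] at this
  have hlen1 : Module.length (ResidueField A) (ResidueField (L ⧸ JL)) = 1 := by
    rw [Module.length_eq_of_surjective (S := ResidueField A) (R := ResidueField (L ⧸ JL))
      (M := ResidueField (L ⧸ JL)) hres]
    exact Module.length_eq_one _ _
  -- the chain of lengths
  have h1 : (hilbertSamuelFun L 1 n : ℕ∞) = Module.length L (L ⧸ JL) :=
    hilbertSamuelFun_one_eq_length L n
  have h2 : Module.length L (L ⧸ JL) = Module.length (L ⧸ JL) (L ⧸ JL) :=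
    Module.length_eq_of_surjective (S := L) (R := L ⧸ JL) (M := L ⧸ JL)
      Ideal.Quotient.mk_surjective
  have h3 : Module.length A (L ⧸ JL) = Module.length (L ⧸ JL) (L ⧸ JL) := by
    rw [IsLocalRing.length_restrictScalars A (L ⧸ JL) (L ⧸ JL), hlen1, mul_one]
  have h4 : Module.length A (L ⧸ JL) =
      Module.length A (A[X] ⧸ (𝔑 ^ (n + 1)).restrictScalars A) := by
    rw [(Submodule.Quotient.restrictScalarsEquiv A (𝔑 ^ (n + 1))).length_eq]
    exact (((IsLocalization.AtPrime.equivQuotMaximalIdealPow 𝔑 L (n + 1)).toLinearEquiv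
      ).restrictScalars A).length_eq.symm
  have h5 := length_quotient_comap_evalRingHom_zero_pow (A := A) n
  rw [← h𝔑] at h5
  have : (hilbertSamuelFun L 1 n : ℕ∞) = hilbertSamuelFun A 2 n := by
    rw [h1, h2, ← h3, h4, h5]
  exact_mod_cast this

include h𝔑 in
/-- **`H^{(0)}_{A[X]_𝔑} = H^{(1)}_A`** for `𝔑 = (𝔪, X)`: the Hilbert function of the point extension
`A⟨X⟩ = A[X]_{(𝔪,X)}` is the once-summed Hilbert function of `A` (`gr_𝔑 = gr_𝔪(A)[X̄]`).
[cite: CossartJannsenSaito2020, proof of Thm. 3.10, p. 47] -/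
theorem hilbertFun_pointExtension : hilbertFun L = hilbertSamuelFun A 1 := by
  apply psum_injective
  funext n
  have h := hilbertSamuelFun_one_pointExtension 𝔑 h𝔑 L n
  rw [hilbertSamuelFun, iterPSum_one] at h
  rw [h, hilbertSamuelFun, hilbertSamuelFun, show (2 : ℕ) = 1 + 1 from rfl, iterPSum_add,
    iterPSum_one]

end Localization

/-! ## The point extension at an arbitrary rational point `X = a` -/

section Point

variable [IsNoetherianRing A] (a : A) (𝔑 : Ideal A[X])
  (h𝔑 : 𝔑 = (maximalIdeal A).comap (evalRingHom a)) [𝔑.IsPrime]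
  (L : Type v) [CommRing L] [IsLocalRing L] [IsNoetherianRing L] [Algebra A[X] L]
  [IsLocalization.AtPrime L 𝔑]

include h𝔑 in
/-- **`H^{(1)}_{A[X]_{𝔑_a}}(n) = H^{(2)}_A(n)`** for the maximal ideal `𝔑_a = (𝔪, X − a)` of any
rational point `a ∈ A` and any localization `L` of `A[X]` at `𝔑_a` which is a Noetherian local ring:
the `A`-automorphism `X ↦ X + a` of `A[X]` (Mathlib `Polynomial.taylorEquiv`) carries `𝔑_a` to
`𝔑_0 = (𝔪, X)` and presents `L` as a localization at `𝔑_0`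
(`IsLocalization.isLocalization_of_base_ringEquiv`), where `hilbertSamuelFun_one_pointExtension`
applies. [cite: CossartJannsenSaito2020, proof of Thm. 3.10, p. 47] -/
theorem hilbertSamuelFun_one_pointExtension_eval (n : ℕ) :
    hilbertSamuelFun L 1 n = hilbertSamuelFun A 2 n := by
  obtain ⟨𝔑₀, h𝔑₀⟩ : ∃ 𝔑₀ : Ideal A[X], 𝔑₀ = (maximalIdeal A).comap (evalRingHom 0) := ⟨_, rfl⟩
  haveI : 𝔑₀.IsMaximal := h𝔑₀ ▸ isMaximal_comap_evalRingHom 0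
  let τ : A[X] ≃+* A[X] := (taylorEquiv a).toRingEquiv
  have hτ : ∀ p, τ p = taylor a p := fun _ => rfl
  have hmem : ∀ p : A[X], p ∈ 𝔑 ↔ τ p ∈ 𝔑₀ := fun p => by
    rw [h𝔑, h𝔑₀, Ideal.mem_comap, coe_evalRingHom, mem_comap_evalRingHom_zero, hτ,
      taylor_coeff_zero]
  have hmap : 𝔑.primeCompl.map τ = 𝔑₀.primeCompl := by
    ext y
    constructor
    · rintro ⟨x, hx, rfl⟩
      exact fun hy => hx ((hmem x).mpr hy)
    · intro hy
      refine ⟨τ.symm y, fun hx => hy ?_, τ.apply_symm_apply y⟩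
      have := (hmem _).mp hx
      rwa [τ.apply_symm_apply] at this
  have hloc := IsLocalization.isLocalization_of_base_ringEquiv 𝔑.primeCompl L τ
  rw [hmap] at hloc
  letI : Algebra A[X] L := ((algebraMap A[X] L).comp τ.symm.toRingHom).toAlgebra
  haveI : IsLocalization.AtPrime L 𝔑₀ := hloc
  exact hilbertSamuelFun_one_pointExtension 𝔑₀ h𝔑₀ L n

include h𝔑 in
/-- **`H^{(0)}_{A[X]_{𝔑_a}} = H^{(1)}_A`** for `𝔑_a = (𝔪, X − a)`, `a ∈ A`: the Hilbert function of
the local ring of `𝔸¹_A` at a rational point of the closed fibre is the once-summed Hilbert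
function of `A`. [cite: CossartJannsenSaito2020, proof of Thm. 3.10, p. 47] -/
theorem hilbertFun_pointExtension_eval : hilbertFun L = hilbertSamuelFun A 1 := by
  apply psum_injective
  funext n
  have h := hilbertSamuelFun_one_pointExtension_eval a 𝔑 h𝔑 L n
  rw [hilbertSamuelFun, iterPSum_one] at h
  rw [h, hilbertSamuelFun, hilbertSamuelFun, show (2 : ℕ) = 1 + 1 from rfl, iterPSum_add,
    iterPSum_one]

end Point

end Literature.RingTheory.HilbertSamuel

end
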